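import Summits.NavierStokesRegularity.NavierStokesRegularity.Theorems.LerayQuarterDissipationFiniteDissipationLiouvilleQuietCore
import Literature.Analysis.FluidPDE.LocalBiotSavartCalculus
import Literature.Analysis.FluidPDE.HarmonicLiouvilleLp
import HarnessLib

/-!
# Crux `FiniteDissipationLiouville` (stmt-NavierStokesRegularity-22144): the QUIET-VORTICITY core
# leaf — a finite-dissipation Type-I profile which, at ONE instant, is nearly irrotational on ONE
# parabolic core ball is regular at the apex

Theorems file of route `LerayQuarterDissipation` (seat ns-lqd-p2 g7; `--supports` the crux; a
vorticity companion of the quiet-core leaves `QuietCore.*`, p606436). Navier–Stokes regularity is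
NOT proved by anything here; no summit is.

`𝒟_{C,K}`: Type-I ancient mild fields (KNSS gauge, `IsTypeIAncientMild C w`) with the law
`∫ ‖∇w(s)‖² ≤ K/√(−s)`. The scale-invariant vorticity size is `(−t)‖curl w(t, x)‖`.

* `quietVorticityCore_leaf` — for all `C, K` and every similarity radius `r > 0` there is
  `δ = δ(C,K,r) > 0` such that a member of `𝒟_{C,K}` having ONE instant `t < 0` with
  `(−t)‖curl w(t,x)‖ ≤ δ` for all `x ∈ B(0, r√(−t))` is bounded on some backward cylinder at the
  origin;
* `vorticityCore_floor_of_singular` — contrapositive: **a SINGULAR member keeps scaled vorticity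
  `> δ(C,K,r)` somewhere in EVERY core ball `B(0, r√(−t))` at EVERY instant — the vicinity of a
  Type-I finite-dissipation singularity is never nearly irrotational.**

Mechanism: scale the instant to `−1`; along a putative sequence of singular counterexamples with
`δ = 1/(k+1)` the KNSS limit `W` (compactness across members + persistence) has `curl W(−1) = 0` on
`B(0,r)` (pointwise convergence of the gradients, `curl = curlCLM ∘ D`); the vorticity of the
ANALYTIC slice is analytic (`IsTypeIAncientMild.analyticOnNhd_slice_univ`, `AnalyticOnNhd.fderiv`)
so it vanishes on all of `ℝ³` (identity theorem); an irrotational divergence-free field is harmonic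
(`curl_curl_eq_neg_laplacian`), and a harmonic slice in `L⁶(ℝ³)` (`Birth.memLp_six_slice`) is zero
(`eq_zero_of_harmonic_memLp_inner`, Tsai's Liouville step) — contradicting the singularity by forward
uniqueness from the zero slice (`CalmSlice.not_singular_of_zero_slice`). Tool: `curl_nsRescale`.

HONEST FRAMING. `δ(C,K,r)` is by compactness; portrait fact, removes no DSS scenario.

References: Koch–Nadirashvili–Seregin–Šverák 2009, §4; Lemarié-Rieusset 2016, Thm 9.12; Tsai 1998,
pp. 48–49 (harmonic Liouville in `L^q`); Majda–Bertozzi 2002, Prop. 2.16 (`−Δv = curl ω`).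
-/

noncomputable section

-- the summit and its single sub-problem share the name (CONVENTIONS §1), as in every Theorems file
set_option linter.dupNamespace false

namespace Summit.NavierStokesRegularity.NavierStokesRegularity.Theorems.FiniteDissipationLiouville.QuietVorticity

open MeasureTheory Set Filter Topology Metric Function
open Literature.Analysis Literature.Analysis.FluidPDE
open Summit.NavierStokesRegularity.NavierStokesRegularity.Theorems.FiniteDissipationLiouville
open scoped ENNReal NNReal Laplacian

/-! ### Tools -/

/-- **Vorticity of the parabolic rescaling**: `curl w_c(s)(x) = c² curl w(c²s)(cx)`
(`curl = curlCLM ∘ D` and `D w_c(s)(x) = c² Dw(c²s)(cx)`). [cite: KochNadirashviliSereginSverak2009, §1 (1.2) (arXiv:0709.3599 p. 2)] -/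
theorem curl_nsRescale (c : ℝ) (u : ℝ → EuclideanSpace ℝ (Fin 3) → EuclideanSpace ℝ (Fin 3))
    (s : ℝ) (x : EuclideanSpace ℝ (Fin 3)) :
    curl (nsRescale c u s) x = (c * c) • curl (u (c ^ 2 * s)) (c • x) := by
  rw [curl_eq_curlCLM, curl_eq_curlCLM, RecurrentReductionD.fderiv_nsRescale, map_smul]

/-- **An irrotational slice of a member of `𝒟_{C,K}` vanishes identically**: `curl w(s) ≡ 0` and
`div w(s) = 0` make the slice harmonic (`−Δ = curl curl`), and a harmonic field in `L⁶(ℝ³)`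
(`Birth.memLp_six_slice`) is zero (Liouville in `L^q`). [cite: Tsai1998, pp. 48–49] [cite: MajdaBertozziCUP2002, Prop. 2.16] -/
theorem slice_eq_zero_of_curl_eq_zero {C K : ℝ}
    {w : ℝ → EuclideanSpace ℝ (Fin 3) → EuclideanSpace ℝ (Fin 3)}
    (hw : IsTypeIAncientMild C w)
    (hlaw : ∀ s : ℝ, s < 0 →
      ∫⁻ x, ‖fderiv ℝ (w s) x‖ₑ ^ 2 ≤ ENNReal.ofReal (K / Real.sqrt (-s)))
    {s : ℝ} (hs : s < 0) (h0 : ∀ x, curl (w s) x = 0) : ∀ x, w s x = 0 := by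
  have h2 : ContDiff ℝ 2 (w s) := (hw.contDiff_slice hs).of_le (WithTop.coe_le_coe.2 le_top)
  have hcurl0 : curl (w s) = fun _ => (0 : EuclideanSpace ℝ (Fin 3)) := funext h0
  have hΔ : ∀ x, (Δ (w s)) x = 0 := by
    intro x
    have h := curl_curl_eq_neg_laplacian h2 (hw.isDivFree hs) x
    rw [hcurl0] at h
    have hz : curl (fun _ : EuclideanSpace ℝ (Fin 3) => (0 : EuclideanSpace ℝ (Fin 3))) x = 0 := by
      rw [curl_eq_curlCLM]
      have : fderiv ℝ (fun _ : EuclideanSpace ℝ (Fin 3) => (0 : EuclideanSpace ℝ (Fin 3))) x = 0 :=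
        by simp
      rw [this, map_zero]
    rw [hz] at h
    have := congrArg Neg.neg h
    simpa using this.symm
  have hharm : InnerProductSpace.HarmonicOnNhd (w s) univ := harmonicOnNhd_of_laplacian_eq_zero h2 hΔ
  obtain ⟨CL, -, hL6⟩ := Birth.memLp_six_slice
  have hmem : MemLp (w s) 6 volume := (hL6 C K w hw hlaw s hs).1
  have hzero := eq_zero_of_harmonic_memLp_inner hharm (q := 6) (by norm_num) (by norm_num) hmem
  exact fun x => congrFun hzero x

/-- **A slice of a member of `𝒟_{C,K}` irrotational on a ball vanishes identically**: the
vorticity of the analytic slice is analytic and vanishes near `0`, hence everywhere; then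
`slice_eq_zero_of_curl_eq_zero`. [cite: LemarieRieusset2016, Thm. 9.12 (PDF p. 260)] -/
theorem slice_eq_zero_of_curl_eq_zero_on_ball {C K : ℝ}
    {w : ℝ → EuclideanSpace ℝ (Fin 3) → EuclideanSpace ℝ (Fin 3)}
    (hw : IsTypeIAncientMild C w)
    (hlaw : ∀ s : ℝ, s < 0 →
      ∫⁻ x, ‖fderiv ℝ (w s) x‖ₑ ^ 2 ≤ ENNReal.ofReal (K / Real.sqrt (-s)))
    {s : ℝ} (hs : s < 0) {r : ℝ} (hr : 0 < r)
    (h0 : ∀ x ∈ ball (0 : EuclideanSpace ℝ (Fin 3)) r, curl (w s) x = 0) : ∀ x, w s x = 0 := by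
  have han : AnalyticOnNhd ℝ (w s) univ := hw.analyticOnNhd_slice_univ hs
  have hanC : AnalyticOnNhd ℝ (curl (w s)) univ := by
    rw [curl_eq_curlCLM_comp]
    exact (curlCLM).comp_analyticOnNhd han.fderiv
  have hev : curl (w s) =ᶠ[𝓝 (0 : EuclideanSpace ℝ (Fin 3))]
      fun _ => (0 : EuclideanSpace ℝ (Fin 3)) :=
    eventuallyEq_of_mem (ball_mem_nhds 0 hr) fun x hx => h0 x hx
  have hC0 : ∀ x, curl (w s) x = 0 := fun x =>
    AnalyticOnNhd.eqOn_of_preconnected_of_eventuallyEq hanC analyticOnNhd_const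
      (convex_univ.isPreconnected) (mem_univ 0) hev (mem_univ x)
  exact slice_eq_zero_of_curl_eq_zero hw hlaw hs hC0

/-! ### The compactness core -/

/-- **No sequence of singular members of `𝒟_{C,K}` has asymptotically irrotational slices at
`t = −1` on a fixed ball** (compactness, persistence, `curl = curlCLM ∘ D` passes to the pointwise
limit of the gradients, analyticity + harmonic Liouville, forward uniqueness). [cite: KochNadirashviliSereginSverak2009, §4 (arXiv:0709.3599 p. 8)] -/
theorem false_of_quietVorticity_seq {C K r : ℝ} (hr : 0 < r)
    {w : ℕ → ℝ → EuclideanSpace ℝ (Fin 3) → EuclideanSpace ℝ (Fin 3)}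
    (hwk : ∀ k, IsTypeIAncientMild C (w k))
    (hlaw : ∀ k, ∀ s : ℝ, s < 0 →
      ∫⁻ x, ‖fderiv ℝ (w k s) x‖ₑ ^ 2 ≤ ENNReal.ofReal (K / Real.sqrt (-s)))
    (hsing : ∀ k, ∀ ρ > 0, ∀ M : ℝ, ∃ t ∈ Ioo (-(ρ ^ 2)) (0 : ℝ),
      ∃ x ∈ ball (0 : EuclideanSpace ℝ (Fin 3)) ρ, M < ‖w k t x‖)
    (hsmall : ∀ k, ∀ x ∈ ball (0 : EuclideanSpace ℝ (Fin 3)) r,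
      ‖curl (w k (-1)) x‖ ≤ 1 / ((k : ℝ) + 1)) :
    False := by
  obtain ⟨ψ, hψ, W, hW, hunif, -, hgrad⟩ := Compactness.seqLimit hwk
  have hψt : Tendsto ψ atTop atTop := hψ.tendsto_atTop
  have hWlaw : ∀ s : ℝ, s < 0 →
      ∫⁻ x, ‖fderiv ℝ (W s) x‖ₑ ^ 2 ≤ ENNReal.ofReal (K / Real.sqrt (-s)) :=
    Compactness.law_of_seqLimit (Kinf := K) (Kk := fun _ => K) hψt hlaw
      (fun ε hε => Eventually.of_forall fun _ => by linarith) hgrad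
  have hWsing := Compactness.persistent_singularity_seq (w := fun j => w (ψ j))
    (fun j => hwk (ψ j)) (fun j => hlaw (ψ j)) (fun j => hsing (ψ j)) hW hunif
  -- the vorticity of the limit slice vanishes on the ball
  have hball : ∀ x ∈ ball (0 : EuclideanSpace ℝ (Fin 3)) r, curl (W (-1)) x = 0 := by
    intro x hx
    have h1 : Tendsto (fun j => curl (w (ψ j) (-1)) x) atTop (𝓝 (curl (W (-1)) x)) := by
      simp only [curl_eq_curlCLM]
      exact ((curlCLM).continuous.tendsto _).comp (hgrad (-1) (by norm_num) x)
    have hb : Tendsto (fun j => 1 / ((ψ j : ℝ) + 1)) atTop (𝓝 0) :=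
      (tendsto_one_div_add_atTop_nhds_zero_nat (𝕜 := ℝ)).comp hψt
    have h2 : Tendsto (fun j => curl (w (ψ j) (-1)) x) atTop (𝓝 0) :=
      squeeze_zero_norm (fun j => hsmall (ψ j) x hx) hb
    exact tendsto_nhds_unique h1 h2
  have hslice : ∀ x, W (-1) x = 0 :=
    slice_eq_zero_of_curl_eq_zero_on_ball hW hWlaw (by norm_num) hr hball
  exact CalmSlice.not_singular_of_zero_slice hW (by norm_num : (-1 : ℝ) < 0) hslice hWsing

/-! ### The leaf and its contrapositive -/

/-- **Quiet-vorticity core leaf.** For all `C, K, r > 0` there is `δ = δ(C,K,r) > 0` such that a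
member of `𝒟_{C,K}` with ONE instant `t < 0` at which `(−t)‖curl w(t,x)‖ ≤ δ` on `B(0, r√(−t))` is
bounded on some backward cylinder at the origin (scale the instant to `−1`: `curl_nsRescale`; then
`false_of_quietVorticity_seq`). [cite: KochNadirashviliSereginSverak2009, §4 (arXiv:0709.3599 p. 8)] [cite: Tsai1998, pp. 48–49] -/
theorem quietVorticityCore_leaf : ∀ (C K r : ℝ), 0 < r → ∃ δ > 0,
    ∀ (w : ℝ → EuclideanSpace ℝ (Fin 3) → EuclideanSpace ℝ (Fin 3)),
      IsTypeIAncientMild C w →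
      (∀ s : ℝ, s < 0 → ∫⁻ x, ‖fderiv ℝ (w s) x‖ₑ ^ 2 ≤ ENNReal.ofReal (K / Real.sqrt (-s))) →
      (∃ t < 0, ∀ x ∈ ball (0 : EuclideanSpace ℝ (Fin 3)) (r * Real.sqrt (-t)),
        (-t) * ‖curl (w t) x‖ ≤ δ) →
      ¬ (∀ ρ > 0, ∀ M : ℝ, ∃ t ∈ Ioo (-(ρ ^ 2)) (0 : ℝ),
        ∃ x ∈ ball (0 : EuclideanSpace ℝ (Fin 3)) ρ, M < ‖w t x‖) := by
  intro C K r hr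
  by_contra hcon
  push Not at hcon
  choose w' hw' hlaw' hq' hsing' using hcon
  choose t' ht' hq' using hq'
  have hpos : ∀ k : ℕ, (0 : ℝ) < 1 / ((k : ℝ) + 1) := fun k => by positivity
  set w : ℕ → ℝ → EuclideanSpace ℝ (Fin 3) → EuclideanSpace ℝ (Fin 3) :=
    fun k => w' _ (hpos k) with hw_def
  have hw : ∀ k, IsTypeIAncientMild C (w k) := fun k => hw' _ (hpos k)
  have hlaw := fun k => hlaw' _ (hpos k)
  have hsing := fun k => hsing' _ (hpos k)
  set t : ℕ → ℝ := fun k => t' _ (hpos k) with ht_def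
  have ht : ∀ k, t k < 0 := fun k => ht' _ (hpos k)
  have hq := fun k => hq' _ (hpos k)
  set c : ℕ → ℝ := fun k => Real.sqrt (-t k) with hc_def
  have hc : ∀ k, 0 < c k := fun k => Real.sqrt_pos.2 (neg_pos.2 (ht k))
  set v : ℕ → ℝ → EuclideanSpace ℝ (Fin 3) → EuclideanSpace ℝ (Fin 3) :=
    fun k => nsRescale (c k) (w k) with hv_def
  have hv : ∀ k, IsTypeIAncientMild C (v k) := fun k => isTypeIAncientMild_nsRescale (hw k) (hc k)
  have hvlaw : ∀ k, ∀ s : ℝ, s < 0 →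
      ∫⁻ x, ‖fderiv ℝ (v k s) x‖ₑ ^ 2 ≤ ENNReal.ofReal (K / Real.sqrt (-s)) :=
    fun k => RecurrentReductionD.dissipationLaw_nsRescale (hlaw k) (hc k)
  have hvsing : ∀ k, ∀ ρ > 0, ∀ M : ℝ, ∃ t ∈ Ioo (-(ρ ^ 2)) (0 : ℝ),
      ∃ x ∈ ball (0 : EuclideanSpace ℝ (Fin 3)) ρ, M < ‖v k t x‖ :=
    fun k => RecurrentReductionD.singularAtOrigin_nsRescale (hsing k) (hc k)
  have hvsmall : ∀ k, ∀ x ∈ ball (0 : EuclideanSpace ℝ (Fin 3)) r,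
      ‖curl (v k (-1)) x‖ ≤ 1 / ((k : ℝ) + 1) := by
    intro k x hx
    have hc2 : c k ^ 2 = -t k := by rw [hc_def]; exact Real.sq_sqrt (neg_nonneg.2 (ht k).le)
    have e : c k ^ 2 * (-1 : ℝ) = t k := by rw [hc2]; ring
    have hcx : c k • x ∈ ball (0 : EuclideanSpace ℝ (Fin 3)) (r * Real.sqrt (-t k)) := by
      rw [mem_ball_zero_iff] at hx ⊢
      rw [norm_smul, Real.norm_of_nonneg (hc k).le, hc_def]
      dsimp only
      rw [mul_comm r]
      exact mul_lt_mul_of_pos_left hx (hc k)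
    have h1 := hq k (c k • x) hcx
    rw [hv_def]
    dsimp only
    rw [curl_nsRescale, e, norm_smul, Real.norm_of_nonneg (mul_self_nonneg _), ← sq, hc2]
    exact h1
  exact false_of_quietVorticity_seq hr hv hvlaw hvsing hvsmall

/-- **Core vorticity floor of a finite-dissipation Type-I singularity**: for all `C, K, r > 0`
there is `δ(C,K,r) > 0` such that every SINGULAR member of `𝒟_{C,K}` has, at EVERY instant
`t < 0`, a point `x ∈ B(0, r√(−t))` with `δ < (−t)‖curl w(t,x)‖` (contrapositive of
`quietVorticityCore_leaf`). [cite: KochNadirashviliSereginSverak2009, §4 (arXiv:0709.3599 p. 8)] -/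
theorem vorticityCore_floor_of_singular : ∀ (C K r : ℝ), 0 < r → ∃ δ > 0,
    ∀ (w : ℝ → EuclideanSpace ℝ (Fin 3) → EuclideanSpace ℝ (Fin 3)),
      IsTypeIAncientMild C w →
      (∀ s : ℝ, s < 0 → ∫⁻ x, ‖fderiv ℝ (w s) x‖ₑ ^ 2 ≤ ENNReal.ofReal (K / Real.sqrt (-s))) →
      (∀ ρ > 0, ∀ M : ℝ, ∃ t ∈ Ioo (-(ρ ^ 2)) (0 : ℝ),
        ∃ x ∈ ball (0 : EuclideanSpace ℝ (Fin 3)) ρ, M < ‖w t x‖) →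
      ∀ t < 0, ∃ x ∈ ball (0 : EuclideanSpace ℝ (Fin 3)) (r * Real.sqrt (-t)),
        δ < (-t) * ‖curl (w t) x‖ := by
  intro C K r hr
  obtain ⟨δ, hδ, h⟩ := quietVorticityCore_leaf C K r hr
  refine ⟨δ, hδ, fun w hw hlaw hsing t ht => ?_⟩
  by_contra hle
  push Not at hle
  exact h w hw hlaw ⟨t, ht, hle⟩ hsing

end Summit.NavierStokesRegularity.NavierStokesRegularity.Theorems.FiniteDissipationLiouville.QuietVorticity

end
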